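import Mathlib
import Literature.Probability.LatticeModels.LoopO1
import HarnessLib
import Literature.Probability.LatticeModels.LoopO1AllTJoinInequalityFails

/-!
# LoopAizenmanAllT — MOVED (deprecated alias module)

Topic `Literature/Uncategorized`. The refuted "all-t" strengthening `LoopAizenmanAllT` of the
loop-O(1) join bound, its refutation `not_LoopAizenmanAllT` and the kernel-computed `C₄`/`t = 2`
helper lemmas (namespace `LoopAizenmanAllT`), parked here by the gate (accept-time relocation out of
`Summits/CriticalPhenomena/Ising3DConformalLimit/Theorems/JoinForcesU4/Negative/`
`AllTStrengthening.lean`,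
2026-08-15), now live — all 18 declarations byte-identical — in
`Literature/Probability/LatticeModels/LoopO1AllTJoinInequalityFails.lean` (namespace
`Literature.Probability.LatticeModels`; librarian move p95311, 2026-08-16). This module keeps only
deprecated aliases under the old names (no module imports it; it can be deleted by the operator).
-/

namespace Literature.Uncategorized

/-- DEPRECATED alias (librarian move 2026-08-16): this constant is, by definition, the moved
`Literature.Probability.LatticeModels.LoopAizenmanAllT`
(statement byte-identical there); kept as a reducible `abbrev` so that files naming the old
constant keep elaborating. [folklore] -/
@[deprecated Literature.Probability.LatticeModels.LoopAizenmanAllT (since := "2026-08-16")]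
abbrev LoopAizenmanAllT : Prop :=
  Literature.Probability.LatticeModels.LoopAizenmanAllT

@[deprecated Literature.Probability.LatticeModels.LoopAizenmanAllT.C4 (since := "2026-08-16")]
alias LoopAizenmanAllT.C4 := Literature.Probability.LatticeModels.LoopAizenmanAllT.C4

@[deprecated Literature.Probability.LatticeModels.LoopAizenmanAllT.tJoins_univ_eq
  (since := "2026-08-16")]
alias LoopAizenmanAllT.tJoins_univ_eq :=
  Literature.Probability.LatticeModels.LoopAizenmanAllT.tJoins_univ_eq

@[deprecated Literature.Probability.LatticeModels.LoopAizenmanAllT.loopZ_C4_two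
  (since := "2026-08-16")]
alias LoopAizenmanAllT.loopZ_C4_two :=
  Literature.Probability.LatticeModels.LoopAizenmanAllT.loopZ_C4_two

@[deprecated Literature.Probability.LatticeModels.LoopAizenmanAllT.zQ (since := "2026-08-16")]
alias LoopAizenmanAllT.zQ := Literature.Probability.LatticeModels.LoopAizenmanAllT.zQ

@[deprecated Literature.Probability.LatticeModels.LoopAizenmanAllT.z0 (since := "2026-08-16")]
alias LoopAizenmanAllT.z0 := Literature.Probability.LatticeModels.LoopAizenmanAllT.z0

@[deprecated Literature.Probability.LatticeModels.LoopAizenmanAllT.z01 (since := "2026-08-16")]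
alias LoopAizenmanAllT.z01 := Literature.Probability.LatticeModels.LoopAizenmanAllT.z01

@[deprecated Literature.Probability.LatticeModels.LoopAizenmanAllT.z23 (since := "2026-08-16")]
alias LoopAizenmanAllT.z23 := Literature.Probability.LatticeModels.LoopAizenmanAllT.z23

@[deprecated Literature.Probability.LatticeModels.LoopAizenmanAllT.z02 (since := "2026-08-16")]
alias LoopAizenmanAllT.z02 := Literature.Probability.LatticeModels.LoopAizenmanAllT.z02

@[deprecated Literature.Probability.LatticeModels.LoopAizenmanAllT.z13 (since := "2026-08-16")]
alias LoopAizenmanAllT.z13 := Literature.Probability.LatticeModels.LoopAizenmanAllT.z13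

@[deprecated Literature.Probability.LatticeModels.LoopAizenmanAllT.z03 (since := "2026-08-16")]
alias LoopAizenmanAllT.z03 := Literature.Probability.LatticeModels.LoopAizenmanAllT.z03

@[deprecated Literature.Probability.LatticeModels.LoopAizenmanAllT.z12 (since := "2026-08-16")]
alias LoopAizenmanAllT.z12 := Literature.Probability.LatticeModels.LoopAizenmanAllT.z12

@[deprecated Literature.Probability.LatticeModels.LoopAizenmanAllT.tJoins01 (since := "2026-08-16")]
alias LoopAizenmanAllT.tJoins01 := Literature.Probability.LatticeModels.LoopAizenmanAllT.tJoins01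

@[deprecated Literature.Probability.LatticeModels.LoopAizenmanAllT.tJoins23 (since := "2026-08-16")]
alias LoopAizenmanAllT.tJoins23 := Literature.Probability.LatticeModels.LoopAizenmanAllT.tJoins23

@[deprecated Literature.Probability.LatticeModels.LoopAizenmanAllT.reachable_invariant
  (since := "2026-08-16")]
alias LoopAizenmanAllT.reachable_invariant :=
  Literature.Probability.LatticeModels.LoopAizenmanAllT.reachable_invariant

@[deprecated Literature.Probability.LatticeModels.LoopAizenmanAllT.fromEdgeSet_union_adj
  (since := "2026-08-16")]
alias LoopAizenmanAllT.fromEdgeSet_union_adj :=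
  Literature.Probability.LatticeModels.LoopAizenmanAllT.fromEdgeSet_union_adj

@[deprecated Literature.Probability.LatticeModels.LoopAizenmanAllT.jointSum_C4_two
  (since := "2026-08-16")]
alias LoopAizenmanAllT.jointSum_C4_two :=
  Literature.Probability.LatticeModels.LoopAizenmanAllT.jointSum_C4_two

@[deprecated Literature.Probability.LatticeModels.not_LoopAizenmanAllT (since := "2026-08-16")]
alias not_LoopAizenmanAllT := Literature.Probability.LatticeModels.not_LoopAizenmanAllT

end Literature.Uncategorized
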